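import Summits.KontsevichZagierPeriods.KontsevichZagierPeriods.Theorems.FurushoPentagonPentagonInKZCornerPrinciple
import Summits.KontsevichZagierPeriods.KontsevichZagierPeriods.Theorems.FurushoPentagonPentagonInKZCornersCubical
import Summits.KontsevichZagierPeriods.KontsevichZagierPeriods.Theorems.FurushoPentagonPentagonInKZCornersBlowup

/-!
# `PentagonInKZ`: stub `stub_logfreeCorners` — the five corner identities of the atlas

Registered stub `stub_logfreeCorners` of the crux `FurushoPentagon.PentagonInKZ`
(stmt-KontsevichZagierPeriods-11348, line `logfree-gauge-corner-flatness`): the five CORNER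
identities `M0·M5 = M4·M6`, `M0·M7 = M1·M8`, `M2·M10 = M1·M9`, `M2·M11 = M3·M12`,
`M4·M14 = M3·M13` between the log-free (end-regularised) transports of the fifteen paths of the
atlas of the pentagon cell.  They are the corner principle `stub_cornerPrinciple`
(`FurushoPentagonPentagonInKZCornerPrinciple.lean`, this line) instantiated at the three cubical
vertices (`stub_cornersCubical`) and at the two blown-up vertices (`stub_cornersBlowup`) of the
cell (both landed by the second lead, line `edge-normal-newton-leibniz`, with the corner principle
as hypothesis). [cite: Furusho2010, §3]; [cite: Drinfeld1991, §2]
-/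

noncomputable section

namespace Summit.KontsevichZagierPeriods.FurushoPentagon.PentagonInKZ

open Literature.NumberTheory.Transcendental

/-- **Stub `stub_logfreeCorners`: the five corner identities of the log-free transports of the
atlas**, from the corner principle at the five vertices of the pentagon cell.
[cite: Furusho2010, §3] -/
theorem stub_logfreeCorners :
    ∀ (R : Type) [CommRing R] [Algebra ℚ R] (χ : KZ.FormalRep →+ R), (∀ c ∈ KZ.relations, χ c = 0) → (∀ x y : KZ.FormalRep, χ (x * y) = χ x * χ y) → (∃ u : KZ.FormalRep, χ u = 1) → ∀ (I : (p : Fin 15) → (w : List (Fin 3)) → KZ.IntegralRep w.length), (∀ (p : Fin 15) (w : List (Fin 3)), w.getLast? ≠ some 0 → (I p w).domain = {t | (∀ i, 0 < t i ∧ t i < (![1/2, 1/2, 1/2, 1/2, 1/2, 1/2, 1/2, 1/2, 1/2, 1/2, 1, 1, 1/2, 1/2, 1/2] : Fin 15 → ℝ) p) ∧ StrictAnti t} ∧ Set.EqOn (I p w).integrand (fun t => ∏ i, 1 / (t i - (![![0, 1, 2], ![0, 1, -1], ![0, 1, 2], ![0, 1, -1], ![0, 1, 2], ![0, 1, 2],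 ![0, 1, 2], ![0, 1, 2], ![0, 1, 2], ![0, 1, 2], ![0, -1, 2], ![0, -1, 2], ![0, 1, 2], ![0, 1, 2], ![0, 1, 2]] : Fin 15 → Fin 3 → ℝ) p (w.get i))) (I p w).domain) → ∀ (P : Fin 15 → NCSeries (Fin 3) R), (∀ (p : Fin 15) (W : List (Fin 3)), P p W = if W = [] then 1 else Shuffle.pair (fun w => χ (KZ.of (I p w))) (Shuffle.regEnd 0 W)) → ∀ (N : ℕ) (a b c d e : DrinfeldKohnoTrunc R (Fin 4) N), a = DrinfeldKohnoTrunc.t R N 0 1 → b = DrinfeldKohnoTrunc.t R N 0 2 → c = DrinfeldKohnoTrunc.t R N 1 2 → d = DrinfeldKohnoTrunc.t R N 1 3 → e = DrinfeldKohnoTrunc.t R N 2 3 → ∀ (M : Fin 15 → DrinfeldKohnoTrunc R (Fin 4) N), (∀ p : Fin 15, M p = NCSeries.evalTrunc N ((![![a + b + c, e, d], ![c, a, d], ![c + d + e, a + a + b + c, d], ![e, a + b + c, d], ![a, c, d], ![a, c, 0], ![a + b + c, e, 0], ![c, a, 0], ![a + b + c, d + e, 0], ![c + d + e, a + b + c,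 0], ![c, d, 0], ![e, d, 0], ![c + d + e, a, 0], ![a, c + d, 0], ![e, a + b + c, 0]] : Fin 15 → Fin 3 → DrinfeldKohnoTrunc R (Fin 4) N) p) (P p)) → M 0 * M 5 = M 4 * M 6 ∧ M 0 * M 7 = M 1 * M 8 ∧ M 2 * M 10 = M 1 * M 9 ∧ M 2 * M 11 = M 3 * M 12 ∧ M 4 * M 14 = M 3 * M 13 := by
  intro R _ _ χ hrel hmul hunit I hI P hP N a b c d e ha hb hc hd he M hM
  obtain ⟨C1, C2, C5⟩ := stub_cornersCubical stub_cornerPrinciple R χ hrel hmul hunit I hI P hP N a b c d e ha hb hc hd he M hM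
  obtain ⟨C3, C4⟩ := stub_cornersBlowup stub_cornerPrinciple R χ hrel hmul hunit I hI P hP N a b c d e ha hb hc hd he M hM
  exact ⟨C1, C2, C3, C4, C5⟩

end Summit.KontsevichZagierPeriods.FurushoPentagon.PentagonInKZ
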